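import Summits.BirchSwinnertonDyer.BirchSwinnertonDyer.Theses.ResidualThetaTransportAtTwo
import Summits.BirchSwinnertonDyer.BirchSwinnertonDyer.Theorems.ResidualThetaTransportAtTwoRlfOfTwistedEventualLevelDescent
import Summits.BirchSwinnertonDyer.BirchSwinnertonDyer.Theorems.ResidualThetaTransportAtTwoRlfTwistedAmbientGeneric
import Summits.BirchSwinnertonDyer.BirchSwinnertonDyer.Theorems.ResidualThetaTransportAtTwoRlfTwistedLiftPlusTwoOfEventual
import Summits.BirchSwinnertonDyer.BirchSwinnertonDyer.Theorems.ResidualThetaTransportAtTwoRlfTwistedEventualPlusLiftAlt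
import Summits.BirchSwinnertonDyer.BirchSwinnertonDyer.Theorems.ResidualThetaTransportAtTwoRlfSharpEigenFinite
import HarnessLib

/-!
# Item 23110 `ResidualLambdaFormulaNegDiscAtTwo` BY NAME from PRINT {weak Leopoldt at `2`, Prop. 4.12} + ONE named input: the `±`-duality
# at `2` for the Greenberg twists, `hdual_Alt(u)` (Kim 2007 Prop. 3.18 read at `2`, twisted, level `ℚ`), for `u` outside a finite set —
# road T's closer with LIFT⁺₂, (TCAS-K)_ev AND H-FIN discharged

Route `ResidualThetaTransportAtTwo` (RTT, crux r201, stmt-BirchSwinnertonDyer-23110) / `ThetaPartnerAtTwo` (TP2, aside r205). Seat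
`prover-bsd-wall-tp2-p2x` g12 LEAD; derived from w3 g12's door `…RlfOfPlusDualAltDoor` (p666195: inputs hdual_Alt ∧ hfinE) by DISCHARGING
`hfinE` with the lead's theorem `SharpEigen.finite_setOf_not_exists_uniformExponent_sharp_two` (p666639). `--supports
stmt-BirchSwinnertonDyer-23110`. THEOREMS ONLY; LEAF file (imports the route file and route-independent helpers only).

* **`residualLambdaFormulaNegDiscAtTwo_of_print_of_plusDualAlt (hWL) (h412) (hD)`** : the RTT route decl BY NAME, where
  `hD` = «for every cyclotomic datum, admissible `S₀`, curve `E` of the branch with `X⁺` torsion and `μ = 0`: a finite `B ⊆ ℤ` with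
  `hdual_Alt(u)` for all odd `u ∉ B`» (binder VERBATIM the `hdual` of `TwistedPT.hlevEventual_two_of_plusDualAlt_of_eigen` at `ε = 1`);
* `residualLambdaFormulaNegDiscAtTwo_TP2_of_print_of_plusDualAlt` — the TP2 twin.

Proof: pick `u` odd outside `B ∪ B_fin ∪ (finite set of (ii))` (`TwistedSurj.exists_twistedCoinv_H1Sigma_of_print`), get `hfinE(u)` from
`B_fin`, then `rlf2_of_twistedEventualLevelDescent` with LIFT⁺₂ from `liftPlusTwo_of_liftPlusEventual` ∘ `liftPlusEventual_two_of_plusDualAlt_of_eigen`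
and (TCAS-K)_ev from `hlevEventual_two_of_plusDualAlt_of_eigen`. CONDITIONAL on PRINT (hWL, h412) and on `hD`; closes nothing by itself;
BSD is not proved by any of this. [cite: GreenbergLNM1716, §4 Props. 4.12–4.14 (pp. 119–124)] [cite: Kim2007ParityConjecture, Prop. 3.18]
-/

set_option autoImplicit false
set_option linter.dupNamespace false

noncomputable section

open scoped Classical NumberField AddSubgroup

open NumberField IsDedekindDomain Field

namespace Summit.BirchSwinnertonDyer.BirchSwinnertonDyer.Theorems.SignedEC.TwistedLocalDescent

open Literature.NumberTheory.EllipticCurves Literature.NumberTheory.GaloisRepresentations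
  Literature.NumberTheory.GaloisCohomology WeierstrassCurve ZpExtension Literature.NumberTheory.EllipticCurves.Kobayashi2003
  Literature.NumberTheory.EllipticCurves.GreenbergVatsal2000 Literature.NumberTheory.EllipticCurves.GreenbergSelmer
  Literature.NumberTheory.EllipticCurves.Rank1Residual

/-- **Item 23110 BY NAME from print + H-PLUSDUAL-alt(u) ∧ H-FIN(u) for generic odd `u` — nothing else displayed.** Binders VERBATIM
those of the lead's `TwistedPT.hlevEventual_two_of_plusDualAlt_of_eigen` / `liftPlusEventual_two_of_plusDualAlt_of_eigen` at `ε = 1`.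
CONDITIONAL; closes nothing. [cite: GreenbergLNM1716, §4 Props. 4.12–4.14 (pp. 119–124)] [cite: GreenbergVatsal2000, §2 Prop. (2.1) and (10)]
[cite: BDKim2013, Thm. 1.1] -/
theorem residualLambdaFormulaNegDiscAtTwo_of_print_of_plusDualAlt
    (hWL : Greenberg1999.h1SigmaInfty_rank_eq_one)
    (h412 : Greenberg1999.prop412_noFiniteSubmodule_H1Sigma_of_rank_one)
    (hDF : ∀ (κ : ZpExtension ℚ 2) (γ : Field.absoluteGaloisGroup ℚ), κ.IsCyclotomic → κ.IsTopGenerator γ →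
      ∀ (S₀ : Finset (HeightOneSpectrum (𝓞 ℚ))), (∀ v ∈ S₀, ((2 : ℕ) : 𝓞 ℚ) ∉ v.asIdeal) →
      ∀ (E : WeierstrassCurve ℚ) [E.IsElliptic] [E.IsGloballyMinimal], GoodSS E 2 → E.frobeniusTrace 2 = 0 → E.Δ < 0 →
        (∀ v : HeightOneSpectrum (𝓞 ℚ), ¬ E.HasGoodReductionAt v → v ∈ S₀) →
      ∀ (D : SignedSelmerDualData E κ γ 1) [Module.Finite (IwasawaAlgebra 2) D.X],
        Module.IsTorsion (IwasawaAlgebra 2) D.X → D.mu = 0 →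
      ∃ B : Set ℤ, B.Finite ∧ ∀ u : ℤ, u ∉ B → ∀ hu : (2 : ℤ) ∣ u - 1,
        (∀ (J : ℕ) (u' : ℤ) (hu' : (2 : ℤ) ∣ u' - 1) (huu' : ((2 : ℤ) ^ J) ∣ u * u' - 1)
      (e : E.geomTorsion ((2 ^ J : ℕ) : ℤ) → E.geomTorsion ((2 ^ J : ℕ) : ℤ) → AlgebraicClosure ℚ)
      (hμ : ∀ S T, e S T ^ (2 ^ J) = 1) (hadd₁ : ∀ S₁ S₂ T, e (S₁ + S₂) T = e S₁ T * e S₂ T)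
      (hadd₂ : ∀ S T₁ T₂, e S (T₁ + T₂) = e S T₁ * e S T₂)
      (hgal : ∀ (σ : absoluteGaloisGroup ℚ) (S T : E.geomTorsion ((2 ^ J : ℕ) : ℤ)), σ • e S T = e (σ • S) (σ • T))
      (halt : ∀ T, e T T = 1) (hnondeg : ∀ T, (∀ S, e S T = 1) → T = 0)
      [Finite (E.geomTorsion ((2 ^ J : ℕ) : ℤ))]
      (inv : LocalInvariants ℚ (2 ^ J)), inv.IsPerfect → inv.SumLocalTermEqZero → inv.UnramifiedOrthogonal →
      ∀ (v : HeightOneSpectrum (𝓞 ℚ)), ((2 : ℕ) : 𝓞 ℚ) ∈ v.asIdeal →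
      ∀ y' : galoisCohomology ((E.twistedTorsionGaloisModule 2 κ J u' hu').restrictField (v.adicCompletion ℚ)) 1,
        galoisCohomology.map ((E.twistedWeilDual 2 κ J hu hu' huu' e hμ hadd₁ hadd₂ hgal).restrictField (v.adicCompletion ℚ)) 1 y' ∈
            inv.dualLocalCondition (E.twistedTorsionGaloisModule 2 κ J u hu) (Sum.inr v)
              (E.twistedTorsionLocalKummer 2 κ J u hu (v.adicCompletion ℚ)
                (⨆ n : ℕ, signedLocalPoints κ (v.adicCompletion ℚ) E 1 n)) →
        y' ∈ E.twistedTorsionLocalKummer 2 κ J u' hu' (v.adicCompletion ℚ) (⨆ n : ℕ, signedLocalPoints κ (v.adicCompletion ℚ) E 1 n))) :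
    Summit.BirchSwinnertonDyer.BirchSwinnertonDyer.Theses.ResidualThetaTransportAtTwo.ResidualLambdaFormulaNegDiscAtTwo := by
  intro κ γ hκ hγ S₀ hS2
  refine ⟨0, fun E _ _ hss ha hΔ hS D _ hX hμ ↦ ?_⟩
  obtain ⟨B, hB, hDFu⟩ := hDF κ γ hκ hγ S₀ hS2 E hss ha hΔ hS D hX hμ
  have hgood : ∀ v : HeightOneSpectrum (𝓞 ℚ), v ∉ S₀ → ((2 : ℕ) : 𝓞 ℚ) ∉ v.asIdeal → E.HasGoodReductionAt v :=
    fun v hv _ ↦ by by_contra hng; exact hv (hS v hng)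
  -- H-FIN is a theorem: enlarge `B` by the finite exceptional set of `SharpEigen.finite_setOf_not_exists_uniformExponent_sharp_two`
  have hBfin := SharpEigen.finite_setOf_not_exists_uniformExponent_sharp_two E hΔ κ hκ hγ S₀ hS2 D hX
  obtain ⟨u, huB, hu, hH⟩ := TwistedSurj.exists_twistedCoinv_H1Sigma_of_print hWL h412 E 2 κ γ hκ hγ S₀ hgood _ (hB.union hBfin)
  rw [Set.mem_union, not_or] at huB
  have hu' : (2 : ℤ) ∣ u - 1 := by exact_mod_cast hu
  have hdual := hDFu u huB.1 hu'
  have hfinE' := huB.2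
  simp only [Set.mem_setOf_eq, not_and, not_not] at hfinE'
  have hfinE := hfinE' hu'
  simpa only [Nat.add_zero] using
    rlf2_of_twistedEventualLevelDescent κ γ hκ hγ S₀ hS2 E hss ha hΔ hS D hX hμ (u := u) (by exact_mod_cast hu') hH
      (TwistedPT.liftPlusTwo_of_liftPlusEventual E hss ha S₀ κ hκ hγ u hu'
        (fun J x₂ ↦ TwistedPT.liftPlusEventual_two_of_plusDualAlt_of_eigen E hss S₀ κ hγ u hu' 1 hS2 hS hdual hfinE J x₂))
      (fun J t ↦ TwistedPT.hlevEventual_two_of_plusDualAlt_of_eigen E hss S₀ κ hγ u hu' 1 hS2 hS hdual hfinE J t)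

/-- **The same for the TP2 decl** `Theses.ThetaPartnerAtTwo.ResidualLambdaFormulaNegDiscAtTwo` (identical text).
[cite: GreenbergLNM1716, §4 Props. 4.12–4.14 (pp. 119–124)] [cite: GreenbergVatsal2000, §2 Prop. (2.1) and (10)] -/
theorem residualLambdaFormulaNegDiscAtTwo_TP2_of_print_of_plusDualAlt
    (hWL : Greenberg1999.h1SigmaInfty_rank_eq_one)
    (h412 : Greenberg1999.prop412_noFiniteSubmodule_H1Sigma_of_rank_one)
    (hDF : ∀ (κ : ZpExtension ℚ 2) (γ : Field.absoluteGaloisGroup ℚ), κ.IsCyclotomic → κ.IsTopGenerator γ →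
      ∀ (S₀ : Finset (HeightOneSpectrum (𝓞 ℚ))), (∀ v ∈ S₀, ((2 : ℕ) : 𝓞 ℚ) ∉ v.asIdeal) →
      ∀ (E : WeierstrassCurve ℚ) [E.IsElliptic] [E.IsGloballyMinimal], GoodSS E 2 → E.frobeniusTrace 2 = 0 → E.Δ < 0 →
        (∀ v : HeightOneSpectrum (𝓞 ℚ), ¬ E.HasGoodReductionAt v → v ∈ S₀) →
      ∀ (D : SignedSelmerDualData E κ γ 1) [Module.Finite (IwasawaAlgebra 2) D.X],
        Module.IsTorsion (IwasawaAlgebra 2) D.X → D.mu = 0 →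
      ∃ B : Set ℤ, B.Finite ∧ ∀ u : ℤ, u ∉ B → ∀ hu : (2 : ℤ) ∣ u - 1,
        (∀ (J : ℕ) (u' : ℤ) (hu' : (2 : ℤ) ∣ u' - 1) (huu' : ((2 : ℤ) ^ J) ∣ u * u' - 1)
      (e : E.geomTorsion ((2 ^ J : ℕ) : ℤ) → E.geomTorsion ((2 ^ J : ℕ) : ℤ) → AlgebraicClosure ℚ)
      (hμ : ∀ S T, e S T ^ (2 ^ J) = 1) (hadd₁ : ∀ S₁ S₂ T, e (S₁ + S₂) T = e S₁ T * e S₂ T)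
      (hadd₂ : ∀ S T₁ T₂, e S (T₁ + T₂) = e S T₁ * e S T₂)
      (hgal : ∀ (σ : absoluteGaloisGroup ℚ) (S T : E.geomTorsion ((2 ^ J : ℕ) : ℤ)), σ • e S T = e (σ • S) (σ • T))
      (halt : ∀ T, e T T = 1) (hnondeg : ∀ T, (∀ S, e S T = 1) → T = 0)
      [Finite (E.geomTorsion ((2 ^ J : ℕ) : ℤ))]
      (inv : LocalInvariants ℚ (2 ^ J)), inv.IsPerfect → inv.SumLocalTermEqZero → inv.UnramifiedOrthogonal →
      ∀ (v : HeightOneSpectrum (𝓞 ℚ)), ((2 : ℕ) : 𝓞 ℚ) ∈ v.asIdeal →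
      ∀ y' : galoisCohomology ((E.twistedTorsionGaloisModule 2 κ J u' hu').restrictField (v.adicCompletion ℚ)) 1,
        galoisCohomology.map ((E.twistedWeilDual 2 κ J hu hu' huu' e hμ hadd₁ hadd₂ hgal).restrictField (v.adicCompletion ℚ)) 1 y' ∈
            inv.dualLocalCondition (E.twistedTorsionGaloisModule 2 κ J u hu) (Sum.inr v)
              (E.twistedTorsionLocalKummer 2 κ J u hu (v.adicCompletion ℚ)
                (⨆ n : ℕ, signedLocalPoints κ (v.adicCompletion ℚ) E 1 n)) →
        y' ∈ E.twistedTorsionLocalKummer 2 κ J u' hu' (v.adicCompletion ℚ) (⨆ n : ℕ, signedLocalPoints κ (v.adicCompletion ℚ) E 1 n))) :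
    Summit.BirchSwinnertonDyer.BirchSwinnertonDyer.Theses.ThetaPartnerAtTwo.ResidualLambdaFormulaNegDiscAtTwo :=
  residualLambdaFormulaNegDiscAtTwo_of_print_of_plusDualAlt hWL h412 hDF

end Summit.BirchSwinnertonDyer.BirchSwinnertonDyer.Theorems.SignedEC.TwistedLocalDescent

end
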